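import Summits.ValiantsHypothesis.ValiantsHypothesis.Theorems.DivisionGapZeroOneTransferStubFormulaGridProjectionAux2

/-!
# Crux `DivisionGap.ZeroOneTransfer` (stmt-ValiantsHypothesis-5066), line `planar-dimer-sign-elimination` —
stub `stub_formulaGridProjection`, support file 3: PARALLEL composition of two-state gadgets

The weighted sum `a • F + b • G` of two two-state gadgets (files 1–2: `msum`, `TwoState⟦…⟧`) is
again a two-state gadget: a six-vertex frame — new ports `p`, `q`; split vertices `pF`, `pG`
adjacent to `p` (the dart `p → pF` carries the coefficient `a`, `p → pG` carries `b`) and `qF`,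
`qG` adjacent to `q`; unit connectors `pF — P_F`, `qF — Q_F`, `pG — P_G`, `qG — Q_G` into the
ports of `F` and `G` — realises it (`twoState_par`; the in/out vertex splitting of
Datta–Kulkarni–Limaye–Mahajan 2010 §4.4 applied to Valiant's 1979 §2 parallel composition of
series–parallel programs).  Proof: attach `F` and then `G` through their two connectors
(`msum_attach`, file 2) and evaluate the six-vertex frame by hand.

Registered sub-goal proved here: `stub_formulaGridProjection_parallelAbstract` (the same statement
with the notation expanded).  Everything over an arbitrary commutative semiring. [folklore]
-/

set_option linter.dupNamespace false

namespace Summit.ValiantsHypothesis.ValiantsHypothesis.Theorems.DivisionGapZeroOneTransfer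

namespace FormulaGridProjection

open Finset

section Parallel

variable {α : Type*} [DecidableEq α] {S : Type*} [CommSemiring S]

/-- `TwoState⟦D, W, p, q, g⟧` (a LOCAL NOTATION, deliberately not a definition): a TWO-STATE GADGET on the
vertex set `D` with ports `p ≠ q` computing `g` — the whole of `D` has matching sum `g` ("active": both
ports matched inside), `D ∖ {p, q}` has matching sum `1` ("inactive"), and `|D|` is even (so the two
mixed states have matching sum `0` by parity).  The two-attachment case of a gadget signature
(Valiant 1979 §2; DKLM 2010 §4.4). -/
local notation3 "TwoState⟦" D ", " W ", " p ", " q ", " g "⟧" =>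
  p ∈ D ∧ q ∈ D ∧ p ≠ q ∧ Even (Finset.card D) ∧ msum D W = g ∧
    msum (Finset.erase (Finset.erase D p) q) W = 1


/-- Erasing two listed elements of a finset. [folklore] -/
theorem erase_erase_eq {s t : Finset α} {x y : α} (h : ∀ v, v ∈ s ↔ v = x ∨ v = y ∨ v ∈ t)
    (hx : x ∉ t) (hy : y ∉ t) : (s.erase x).erase y = t := by
  ext v
  simp only [mem_erase, h]
  constructor
  · rintro ⟨h1, h2, h3 | h3 | h3⟩
    · exact absurd h3 h2
    · exact absurd h3 h1
    · exact h3
  · intro hv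
    exact ⟨fun h' => hy (h' ▸ hv), fun h' => hx (h' ▸ hv), Or.inr (Or.inr hv)⟩

/-- **Parallel composition** `a • F + b • G` (Valiant 1979 §2 with the in/out vertex splitting of
DKLM 2010 §4.4).  Frame: new ports `p`, `q` and four private vertices `pF, pG, qF, qG`; edges
`p — pF` (edge weight `a`), `p — pG` (`b`), `q — qF`, `q — qG` (unit), and unit connectors
`pF — P_F`, `qF — Q_F`, `pG — P_G`, `qG — Q_G` into the ports of the two-state gadgets `F` (value
`gF`) and `G` (value `gG`); nothing else touches the frame or leaves the two gadgets.
Result: a two-state gadget with ports `p`, `q` computing `a * gF + b * gG` (active: exactly one of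
`F`, `G` is active; inactive: both inactive; parity kills the rest). [folklore] -/
theorem twoState_par {DF DG : Finset α} {W : α → α → S} {PF QF PG QG p q pF pG qF qG : α}
    {gF gG a b : S} (hF : TwoState⟦DF, W, PF, QF, gF⟧) (hG : TwoState⟦DG, W, PG, QG, gG⟧)
    (hFG : Disjoint DF DG) (hFfr : Disjoint DF {p, q, pF, pG, qF, qG})
    (hGfr : Disjoint DG {p, q, pF, pG, qF, qG}) (hnd : [p, q, pF, pG, qF, qG].Nodup)
    (zF : ∀ u ∈ DF, ∀ v ∉ DF, W u v ≠ 0 → (u = PF ∧ v = pF) ∨ (u = QF ∧ v = qF))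
    (zG : ∀ u ∈ DG, ∀ v ∉ DG, W u v ≠ 0 → (u = PG ∧ v = pG) ∨ (u = QG ∧ v = qG))
    (np : ∀ v, W p v ≠ 0 → v = pF ∨ v = pG) (nq : ∀ v, W q v ≠ 0 → v = qF ∨ v = qG)
    (npF : ∀ v, W pF v ≠ 0 → v = p ∨ v = PF) (nqF : ∀ v, W qF v ≠ 0 → v = q ∨ v = QF)
    (npG : ∀ v, W pG v ≠ 0 → v = p ∨ v = PG) (nqG : ∀ v, W qG v ≠ 0 → v = q ∨ v = QG)
    (ha : W p pF * W pF p = a) (hb : W p pG * W pG p = b) (hqF : W q qF * W qF q = 1)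
    (hqG : W q qG * W qG q = 1) (hcF : W PF pF * W pF PF = 1) (hcF' : W QF qF * W qF QF = 1)
    (hcG : W PG pG * W pG PG = 1) (hcG' : W QG qG * W qG QG = 1) :
    TwoState⟦(DF ∪ (DG ∪ {p, q, pF, pG, qF, qG})), W, p, q, (a * gF + b * gG)⟧ := by
  -- distinctness and (non-)membership bookkeeping
  simp only [List.nodup_cons, List.mem_cons, List.not_mem_nil, or_false, not_or, List.nodup_nil,
    and_true, not_false_eq_true] at hnd
  obtain ⟨⟨hpq, hppF, hppG, hpqF, hpqG⟩, ⟨hqpF, hqpG, hqqF, hqqG⟩, ⟨hpFpG, hpFqF, hpFqG⟩,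
    ⟨hpGqF, hpGqG⟩, hqFqG⟩ := hnd
  have hs : ∀ {x y : α}, ¬x = y → ¬y = x := fun h h' => h h'.symm
  have hPF := hF.1; have hQF := hF.2.1; have hPG := hG.1; have hQG := hG.2.1
  have nF : ∀ v ∈ ({p, q, pF, pG, qF, qG} : Finset α), v ∉ DF :=
    fun v hv h => disjoint_left.1 hFfr h hv
  have nG : ∀ v ∈ ({p, q, pF, pG, qF, qG} : Finset α), v ∉ DG :=
    fun v hv h => disjoint_left.1 hGfr h hv
  have hPFG : PF ∉ DG := disjoint_left.1 hFG hPF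
  have hQFG : QF ∉ DG := disjoint_left.1 hFG hQF
  have hPGF : PG ∉ DF := fun h => disjoint_left.1 hFG h hPG
  have hQGF : QG ∉ DF := fun h => disjoint_left.1 hFG h hQG
  have mem6 : ∀ v, v ∈ ({p, q, pF, pG, qF, qG} : Finset α) ↔
      v = p ∨ v = q ∨ v = pF ∨ v = pG ∨ v = qF ∨ v = qG := fun v => by
    simp only [mem_insert, mem_singleton]
  -- a frame vertex is never a gadget vertex, in particular never a gadget port
  have neF : ∀ v, v ∈ ({p, q, pF, pG, qF, qG} : Finset α) → ¬v = PF ∧ ¬v = QF :=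
    fun v hv => ⟨fun h => nF v hv (h ▸ hPF), fun h => nF v hv (h ▸ hQF)⟩
  have neG : ∀ v, v ∈ ({p, q, pF, pG, qF, qG} : Finset α) → ¬v = PG ∧ ¬v = QG :=
    fun v hv => ⟨fun h => nG v hv (h ▸ hPG), fun h => nG v hv (h ▸ hQG)⟩
  -- zero darts out of the frame vertices
  have zp : ∀ v, ¬v = pF → ¬v = pG → W p v = 0 := fun v h1 h2 => by
    by_contra h; rcases np v h with rfl | rfl <;> contradiction
  have zq : ∀ v, ¬v = qF → ¬v = qG → W q v = 0 := fun v h1 h2 => by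
    by_contra h; rcases nq v h with rfl | rfl <;> contradiction
  have zpF : ∀ v, ¬v = p → ¬v = PF → W pF v = 0 := fun v h1 h2 => by
    by_contra h; rcases npF v h with rfl | rfl <;> contradiction
  have zpG : ∀ v, ¬v = p → ¬v = PG → W pG v = 0 := fun v h1 h2 => by
    by_contra h; rcases npG v h with rfl | rfl <;> contradiction
  -- the reverse zero pattern: darts from the frame into `G` / into `F`
  have toG : ∀ v ∈ ({p, q, pF, pG, qF, qG} : Finset α), ∀ u ∈ DG, W v u ≠ 0 →
      (v = pG ∧ u = PG) ∨ (v = qG ∧ u = QG) := by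
    intro v hv u hu hne
    have hu' : ¬u ∈ ({p, q, pF, pG, qF, qG} : Finset α) := fun h => nG u h hu
    rw [mem6] at hu'
    simp only [not_or] at hu'
    obtain ⟨h1, h2, h3, h4, h5, h6⟩ := hu'
    rcases (mem6 v).1 hv with rfl | rfl | rfl | rfl | rfl | rfl
    · rcases np u hne with rfl | rfl <;> contradiction
    · rcases nq u hne with rfl | rfl <;> contradiction
    · rcases npF u hne with rfl | rfl; · contradiction
      exact absurd hu hPFG
    · rcases npG u hne with rfl | rfl; · contradiction
      exact Or.inl ⟨rfl, rfl⟩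
    · rcases nqF u hne with rfl | rfl; · contradiction
      exact absurd hu hQFG
    · rcases nqG u hne with rfl | rfl; · contradiction
      exact Or.inr ⟨rfl, rfl⟩
  have toF : ∀ v ∈ ({p, q, pF, pG, qF, qG} : Finset α), ∀ u ∈ DF, W v u ≠ 0 →
      (v = pF ∧ u = PF) ∨ (v = qF ∧ u = QF) := by
    intro v hv u hu hne
    have hu' : ¬u ∈ ({p, q, pF, pG, qF, qG} : Finset α) := fun h => nF u h hu
    rw [mem6] at hu'
    simp only [not_or] at hu'
    obtain ⟨h1, h2, h3, h4, h5, h6⟩ := hu'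
    rcases (mem6 v).1 hv with rfl | rfl | rfl | rfl | rfl | rfl
    · rcases np u hne with rfl | rfl <;> contradiction
    · rcases nq u hne with rfl | rfl <;> contradiction
    · rcases npF u hne with rfl | rfl; · contradiction
      exact Or.inl ⟨rfl, rfl⟩
    · rcases npG u hne with rfl | rfl; · contradiction
      exact absurd hu hPGF
    · rcases nqF u hne with rfl | rfl; · contradiction
      exact Or.inr ⟨rfl, rfl⟩
    · rcases nqG u hne with rfl | rfl; · contradiction
      exact absurd hu hQGF
  -- attaching `G` through `pG`, `qG` to any part `R` of the frame
  have attG : ∀ R : Finset α, R ⊆ {p, q, pF, pG, qF, qG} → pG ∈ R → qG ∈ R →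
      msum (DG ∪ R) W = gG * msum R W + msum ((R.erase pG).erase qG) W := by
    intro R hR hpGR hqGR
    refine msum_attach hG (disjoint_of_subset_right hR hGfr) hpGR hqGR hpGqG
      (fun u hu v hv hne => zG u hu v (nG v (hR hv)) hne)
      (fun v hv u hu hne => toG v (hR hv) u hu hne) hcG hcG'
  -- attaching `F` through `pF`, `qF` to `DG ∪ R`
  have attF : ∀ R : Finset α, R ⊆ {p, q, pF, pG, qF, qG} → pF ∈ R → qF ∈ R →
      msum (DF ∪ (DG ∪ R)) W =
        gF * msum (DG ∪ R) W + msum (((DG ∪ R).erase pF).erase qF) W := by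
    intro R hR hpFR hqFR
    refine msum_attach hF (disjoint_union_right.2 ⟨hFG, disjoint_of_subset_right hR hFfr⟩)
      (mem_union_right _ hpFR) (mem_union_right _ hqFR) hpFqF ?_ ?_ hcF hcF'
    · intro u hu v hv hne
      refine zF u hu v (fun hvF => ?_) hne
      rcases mem_union.1 hv with hvG | hvR
      · exact disjoint_left.1 hFG hvF hvG
      · exact nF v (hR hvR) hvF
    · intro v hv u hu hne
      rcases mem_union.1 hv with hvG | hvR
      · rcases zG v hvG u (disjoint_left.1 hFG hu) hne with ⟨-, rfl⟩ | ⟨-, rfl⟩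
        · exact absurd hu (nF _ (by simp))
        · exact absurd hu (nF _ (by simp))
      · exact toF v (hR hvR) u hu hne
  -- matching sums of the frame pieces
  have hD : (¬p = q ∧ ¬p = pF ∧ ¬p = pG ∧ ¬p = qF ∧ ¬p = qG ∧ ¬q = pF ∧ ¬q = pG ∧ ¬q = qF ∧
      ¬q = qG ∧ ¬pF = pG ∧ ¬pF = qF ∧ ¬pF = qG ∧ ¬pG = qF ∧ ¬pG = qG ∧ ¬qF = qG) ∧
      (¬q = p ∧ ¬pF = p ∧ ¬pG = p ∧ ¬qF = p ∧ ¬qG = p ∧ ¬pF = q ∧ ¬pG = q ∧ ¬qF = q ∧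
      ¬qG = q ∧ ¬pG = pF ∧ ¬qF = pF ∧ ¬qG = pF ∧ ¬qF = pG ∧ ¬qG = pG ∧ ¬qG = qF) :=
    ⟨⟨hpq, hppF, hppG, hpqF, hpqG, hqpF, hqpG, hqqF, hqqG, hpFpG, hpFqF, hpFqG, hpGqF, hpGqG, hqFqG⟩,
      ⟨hs hpq, hs hppF, hs hppG, hs hpqF, hs hpqG, hs hqpF, hs hqpG, hs hqqF, hs hqqG, hs hpFpG,
        hs hpFqF, hs hpFqG, hs hpGqF, hs hpGqG, hs hqFqG⟩⟩
  have hN : (p ∉ DF ∧ q ∉ DF ∧ pF ∉ DF ∧ pG ∉ DF ∧ qF ∉ DF ∧ qG ∉ DF) ∧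
      (p ∉ DG ∧ q ∉ DG ∧ pF ∉ DG ∧ pG ∉ DG ∧ qF ∉ DG ∧ qG ∉ DG) :=
    ⟨⟨nF _ (by simp), nF _ (by simp), nF _ (by simp), nF _ (by simp), nF _ (by simp), nF _ (by simp)⟩,
      ⟨nG _ (by simp), nG _ (by simp), nG _ (by simp), nG _ (by simp), nG _ (by simp), nG _ (by simp)⟩⟩
  have f2 : msum ({p, q, pF, qF} : Finset α) W = a := by
    rw [msum_forced W (a := p) (b := pF) (by simp) (by simp) (hs hppF) ?_,
      erase_erase_eq (t := {q, qF})
        (fun v => by simp only [mem_insert, mem_singleton, or_left_comm])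
        (by simp only [mem_insert, mem_singleton, hD, or_self, not_false_eq_true])
        (by simp only [mem_insert, mem_singleton, hD, or_self, not_false_eq_true]),
      msum_pair W hqqF, hqF, mul_one, ha]
    intro u hu _ hupF
    refine zp u hupF ?_
    simp only [mem_insert, mem_singleton] at hu
    rcases hu with rfl | rfl | rfl | rfl
    exacts [hppG, hqpG, hpFpG, hs hpGqF]
  have f3 : msum ({p, q, pG, qG} : Finset α) W = b := by
    rw [msum_forced W (a := p) (b := pG) (by simp) (by simp) (hs hppG) ?_,
      erase_erase_eq (t := {q, qG})
        (fun v => by simp only [mem_insert, mem_singleton, or_left_comm])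
        (by simp only [mem_insert, mem_singleton, hD, or_self, not_false_eq_true])
        (by simp only [mem_insert, mem_singleton, hD, or_self, not_false_eq_true]),
      msum_pair W hqqG, hqG, mul_one, hb]
    intro u hu _ hupG
    refine zp u ?_ hupG
    simp only [mem_insert, mem_singleton] at hu
    rcases hu with rfl | rfl | rfl | rfl
    exacts [hppF, hqpF, hs hpFpG, hs hpFqG]
  have f1 : msum ({p, q, pF, pG, qF, qG} : Finset α) W = 0 := by
    rw [msum_two W (a := p) (b₁ := pF) (b₂ := pG) (by simp) (by simp) (by simp) (hs hppF)
      (hs hppG) hpFpG (fun u _ _ h1 h2 => zp u h1 h2),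
      msum_isolated W (a := pG) (mem_erase.2 ⟨hs hpFpG, mem_erase.2 ⟨hs hppG, by simp⟩⟩) ?_,
      msum_isolated W (a := pF) (mem_erase.2 ⟨hpFpG, mem_erase.2 ⟨hs hppF, by simp⟩⟩) ?_]
    · ring
    · intro u hu _
      simp only [mem_erase] at hu
      exact zpF u hu.2.1 (neF u hu.2.2).1
    · intro u hu _
      simp only [mem_erase] at hu
      exact zpG u hu.2.1 (neG u hu.2.2).1
  have f5 : msum ({pF, pG, qF, qG} : Finset α) W = 0 := by
    refine msum_isolated W (a := pF) (by simp) fun u hu _ => zpF u ?_ (neF u ?_).1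
    · simp only [mem_insert, mem_singleton] at hu
      rcases hu with rfl | rfl | rfl | rfl
      exacts [hs hppF, hs hppG, hs hpqF, hs hpqG]
    · simp only [mem_insert, mem_singleton] at hu ⊢
      rcases hu with rfl | rfl | rfl | rfl <;> simp
  have sub4 : ({p, q, pG, qG} : Finset α) ⊆ {p, q, pF, pG, qF, qG} := fun v hv => by
    simp only [mem_insert, mem_singleton] at hv ⊢
    rcases hv with rfl | rfl | rfl | rfl <;> simp
  have sub4' : ({pF, pG, qF, qG} : Finset α) ⊆ {p, q, pF, pG, qF, qG} := fun v hv => by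
    simp only [mem_insert, mem_singleton] at hv ⊢
    rcases hv with rfl | rfl | rfl | rfl <;> simp
  have sub2 : ({pG, qG} : Finset α) ⊆ {p, q, pF, pG, qF, qG} := fun v hv => by
    simp only [mem_insert, mem_singleton] at hv ⊢
    rcases hv with rfl | rfl <;> simp
  refine ⟨by simp, by simp, hpq, ?_, ?_, ?_⟩
  · -- parity
    rw [card_union_of_disjoint (disjoint_union_right.2 ⟨hFG, hFfr⟩), card_union_of_disjoint hGfr]
    refine hF.2.2.2.1.add (hG.2.2.2.1.add ?_)
    have h6 : ({p, q, pF, pG, qF, qG} : Finset α).card = 6 := by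
      rw [card_insert_of_notMem (by simp only [mem_insert, mem_singleton, hD, or_self, not_false_eq_true]),
        card_insert_of_notMem (by simp only [mem_insert, mem_singleton, hD, or_self, not_false_eq_true]),
        card_insert_of_notMem (by simp only [mem_insert, mem_singleton, hD, or_self, not_false_eq_true]),
        card_insert_of_notMem (by simp only [mem_insert, mem_singleton, hD, or_self, not_false_eq_true]),
        card_pair hqFqG]
    rw [h6]; decide
  · -- active state
    rw [attF _ Subset.rfl (by simp) (by simp), attG _ Subset.rfl (by simp) (by simp), f1,
      erase_erase_eq (t := {p, q, pF, qF})
        (fun v => by simp only [mem_insert, mem_singleton, or_comm, or_left_comm])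
        (by simp only [mem_insert, mem_singleton, hD, or_self, not_false_eq_true])
        (by simp only [mem_insert, mem_singleton, hD, or_self, not_false_eq_true]),
      f2, erase_erase_eq (t := DG ∪ {p, q, pG, qG})
        (fun v => by simp only [mem_union, mem_insert, mem_singleton, or_comm, or_left_comm, or_assoc])
        (by simp only [mem_union, mem_insert, mem_singleton, hD, hN, or_self, not_false_eq_true])
        (by simp only [mem_union, mem_insert, mem_singleton, hD, hN, or_self, not_false_eq_true]),
      attG _ sub4 (by simp) (by simp), f3,
      erase_erase_eq (t := {p, q})
        (fun v => by simp only [mem_insert, mem_singleton, or_comm, or_left_comm])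
        (by simp only [mem_insert, mem_singleton, hD, or_self, not_false_eq_true])
        (by simp only [mem_insert, mem_singleton, hD, or_self, not_false_eq_true]),
      msum_pair W hpq, zp q hqpF hqpG, zero_mul]
    ring
  · -- inactive state
    rw [erase_erase_eq (t := DF ∪ (DG ∪ {pF, pG, qF, qG}))
        (fun v => by simp only [mem_union, mem_insert, mem_singleton, or_comm, or_left_comm, or_assoc])
        (by simp only [mem_union, mem_insert, mem_singleton, hD, hN, or_self, not_false_eq_true])
        (by simp only [mem_union, mem_insert, mem_singleton, hD, hN, or_self, not_false_eq_true]),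
      attF _ sub4' (by simp) (by simp), attG _ sub4' (by simp) (by simp), f5,
      erase_erase_eq (t := {pF, qF})
        (fun v => by simp only [mem_insert, mem_singleton, or_comm, or_left_comm])
        (by simp only [mem_insert, mem_singleton, hD, or_self, not_false_eq_true])
        (by simp only [mem_insert, mem_singleton, hD, or_self, not_false_eq_true]),
      msum_pair W hpFqF, zpF qF (hs hpqF) (neF qF (by simp)).1, zero_mul,
      erase_erase_eq (t := DG ∪ {pG, qG})
        (fun v => by simp only [mem_union, mem_insert, mem_singleton, or_comm, or_left_comm, or_assoc])
        (by simp only [mem_union, mem_insert, mem_singleton, hD, hN, or_self, not_false_eq_true])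
        (by simp only [mem_union, mem_insert, mem_singleton, hD, hN, or_self, not_false_eq_true]),
      attG _ sub2 (by simp) (by simp), msum_pair W hpGqG, zpG qG (hs hpqG) (neG qG (by simp)).1,
      zero_mul, erase_erase_eq (t := (∅ : Finset α))
        (fun v => by simp only [mem_insert, mem_singleton, Finset.notMem_empty, or_false])
        (Finset.notMem_empty _) (Finset.notMem_empty _), msum_empty]
    ring


end Parallel

end FormulaGridProjection

open Finset FormulaGridProjection in
/-- **Registered sub-goal `stub_formulaGridProjection_parallelAbstract`** of `stub_formulaGridProjection`
(crux stmt-ValiantsHypothesis-5066, line `planar-dimer-sign-elimination`): PARALLEL COMPOSITION of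
two-state gadgets through a six-vertex frame computes `a * gF + b * gG`
(`FormulaGridProjection.twoState_par` with the `TwoState⟦…⟧` notation expanded). [folklore] -/
theorem stub_formulaGridProjection_parallelAbstract : ∀ (α : Type) [DecidableEq α] (S : Type) [CommSemiring S] (DF DG : Finset α) (W : α → α → S) (PF QF PG QG p q pF pG qF qG : α) (gF gG a b : S), (PF ∈ DF ∧ QF ∈ DF ∧ PF ≠ QF ∧ Even (Finset.card DF) ∧ Summit.ValiantsHypothesis.ValiantsHypothesis.Theorems.DivisionGapZeroOneTransfer.FormulaGridProjection.msum DF W = gF ∧ Summit.ValiantsHypothesis.ValiantsHypothesis.Theorems.DivisionGapZeroOneTransfer.FormulaGridProjection.msum (Finset.erase (Finset.erase DF PF) QF) W = 1) → (PG ∈ DG ∧ QG ∈ DG ∧ PG ≠ QG ∧ Even (Finset.card DG) ∧ Summit.ValiantsHypothesis.ValiantsHypothesis.Theorems.DivisionGapZeroOneTransfer.FormulaGridProjection.msum DG W = gG ∧ Summit.ValiantsHypothesis.ValiantsHypothesis.Theorems.DivisionGapZeroOneTransfer.FormulaGridProjection.msum (Finset.erase (Finset.erase DG PG) QG) W = 1)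 → Disjoint DF DG → Disjoint DF ({p, q, pF, pG, qF, qG} : Finset α) → Disjoint DG ({p, q, pF, pG, qF, qG} : Finset α) → [p, q, pF, pG, qF, qG].Nodup → (∀ u ∈ DF, ∀ v ∉ DF, W u v ≠ 0 → (u = PF ∧ v = pF) ∨ (u = QF ∧ v = qF)) → (∀ u ∈ DG, ∀ v ∉ DG, W u v ≠ 0 → (u = PG ∧ v = pG) ∨ (u = QG ∧ v = qG)) → (∀ v, W p v ≠ 0 → v = pF ∨ v = pG) → (∀ v, W q v ≠ 0 → v = qF ∨ v = qG) → (∀ v, W pF v ≠ 0 → v = p ∨ v = PF) → (∀ v, W qF v ≠ 0 → v = q ∨ v = QF) → (∀ v, W pG v ≠ 0 → v = p ∨ v = PG) → (∀ v, W qG v ≠ 0 → v = q ∨ v = QG) → W p pF * W pF p = a → W p pG * W pG p = b → W q qF * W qF q = 1 → W q qG * W qG q = 1 → W PF pF * W pF PF = 1 → W QF qF * W qF QF = 1 → W PG pG * W pG PG = 1 → W QG qG * W qG QG = 1 → (p ∈ (DF ∪ (DG ∪ {p, q, pF, pG, qF, qG})) ∧ q ∈ (DF ∪ (DG ∪ {p,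 q, pF, pG, qF, qG})) ∧ p ≠ q ∧ Even (Finset.card (DF ∪ (DG ∪ {p, q, pF, pG, qF, qG}))) ∧ Summit.ValiantsHypothesis.ValiantsHypothesis.Theorems.DivisionGapZeroOneTransfer.FormulaGridProjection.msum (DF ∪ (DG ∪ {p, q, pF, pG, qF, qG})) W = (a * gF + b * gG) ∧ Summit.ValiantsHypothesis.ValiantsHypothesis.Theorems.DivisionGapZeroOneTransfer.FormulaGridProjection.msum (Finset.erase (Finset.erase (DF ∪ (DG ∪ {p, q, pF, pG, qF, qG})) p) q) W = 1) :=
  fun _ _ _ _ _ _ _ _ _ _ _ _ _ _ _ _ _ _ _ _ _ hF hG hFG hFfr hGfr hnd zF zG np nq npF nqF npG nqG ha hb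
    hqF hqG hcF hcF' hcG hcG' =>
    twoState_par hF hG hFG hFfr hGfr hnd zF zG np nq npF nqF npG nqG ha hb hqF hqG hcF hcF' hcG hcG'

end Summit.ValiantsHypothesis.ValiantsHypothesis.Theorems.DivisionGapZeroOneTransfer
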